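import Literature.AlgebraicGeometry.Motives.HodgeThetaSubalgebraSymplecticRankSix
import Mathlib.LinearAlgebra.Trace
import Mathlib.LinearAlgebra.Projection
import HarnessLib

/-!
# The Θ-subalgebra theorem in rank six, PART 3b: the Killing form of the E³-type skeleton

Family `hodge`, layer `Literature/AlgebraicGeometry/Motives`. Research context: cell `pub-hodge-ring2` (HONEST
FRAMING: research route conditional on HC_CM; not a corollary; Q11.4-sentence-2 already refuted in dim ≥ 3),
Literature lane, programme R13 «generic abelian threefolds» (Moonen–Zarhin 1999 (2.3) Type I(1)). UNCONDITIONAL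
operator algebra; theorems only, no definition, no named fact (D-0026), no `sorry`.

CONTEXT. PART 2b (`SymplecticThetaSix.core_dichotomy`) leaves, besides `𝔰𝔭₆`, the E³-TYPE SKELETON, and PART 3a
(`…Skeleton`) shows that it is the six-dimensional Lie algebra `𝔊 = ⟨C₁, T, B₀⟩ ⊕ ⟨S, E′, F′⟩ ≅ 𝔰𝔩₂ ⊕ 𝔰𝔬₃` with
the multiplication table `[C₁,T] = 2C₁`, `[C₁,B₀] = −T`, `[T,B₀] = 2B₀`, `[𝔞₁, 𝔰] = 0`, `[S,E′] = eE′`,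
`[S,F′] = −eF′`, `[E′,F′] = e⁻¹S` (`e ≠ 0`). The arithmetic exclusion of the skeleton (PART 3c) compares two
invariant forms on `𝔊`: the trace form `β(X,Y) = tr_M(XY)` of the standard representation and the KILLING FORM
`κ(X,Y) = tr_𝔊(ad X ∘ ad Y)`. This file computes, from the multiplication table alone, the values of `κ` that
PART 3c needs (`skeleton_killing`): with `ad X = (L_X − R_X)|_𝔊`,
`κ(S,S) = 2e²`, `κ(B₀,C₁) = κ(C₁,B₀) = 4`, and `κ(S,E′) = κ(S,F′) = κ(T,B₀) = κ(B₀,B₀) = κ(T,C₁) = κ(C₁,C₁) = 0`,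
`κ(s, a) = 0` for `s ∈ {S,E′,F′}`, `a ∈ {C₁,T,B₀}`. Method: `(ad S)² = e²·π_{⟨E′,F′⟩}` and
`ad B₀ ∘ ad C₁ = 2·π_{⟨T,B₀⟩}` are multiples of projections (`LinearMap.IsProj.trace`), the other compositions
are square-zero or zero. (Humphreys §5.1: the Killing form `κ(x,y) = Tr(ad x ad y)` and the worked example of
`𝔰𝔩(2,F)` in the basis `(x,h,y)`, book p. 21–22.)

## References

* [MoonenZarhin1999LowDim] B. Moonen, Yu. Zarhin, Math. Ann. 315 (1999), §2 (2.3), (2.5).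
* [Humphreys1972] J. E. Humphreys, Introduction to Lie algebras and representation theory, GTM 9 (1972),
  §5.1 (Killing form; example `𝔰𝔩(2,F)`) [corpus: book:humphreys1972-introduction-lie-algebras-representation-theory
  p0037 L1–L11].
-/

namespace Literature.AlgebraicGeometry.Motives

namespace HodgeStructure

variable {M : Type*} [AddCommGroup M] [Module ℂ M]

/-- A square-zero endomorphism has trace zero. [folklore] -/
private theorem SymplecticThetaSix.trace_eq_zero_of_comp_self {W : Type*} [AddCommGroup W] [Module ℂ W]
    [FiniteDimensional ℂ W] (f : W →ₗ[ℂ] W) (h : ∀ w, f (f w) = 0) : LinearMap.trace ℂ W f = 0 := by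
  have hnil : IsNilpotent f := ⟨2, by ext w; simp [pow_two, h]⟩
  exact (LinearMap.isNilpotent_trace_of_isNilpotent hnil).eq_zero

/-- An endomorphism which is `c` times a projection onto the plane spanned by two independent vectors has
trace `2c`. [folklore] -/
private theorem SymplecticThetaSix.trace_eq_two_mul {W : Type*} [AddCommGroup W] [Module ℂ W]
    [FiniteDimensional ℂ W] (f : W →ₗ[ℂ] W) {c : ℂ} (hc : c ≠ 0) {g₁ g₂ : W}
    (hli : LinearIndependent ℂ ![g₁, g₂]) (hmem : ∀ w, ∃ u v : ℂ, f w = c • (u • g₁ + v • g₂))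
    (h₁ : f g₁ = c • g₁) (h₂ : f g₂ = c • g₂) : LinearMap.trace ℂ W f = 2 * c := by
  set L : Submodule ℂ W := Submodule.span ℂ (Set.range ![g₁, g₂]) with hL
  have hproj : LinearMap.IsProj L (c⁻¹ • f) := by
    constructor
    · intro w
      obtain ⟨u, v, hw⟩ := hmem w
      rw [LinearMap.smul_apply, hw, smul_smul, inv_mul_cancel₀ hc, one_smul]
      exact Submodule.add_mem _ (Submodule.smul_mem _ _ (Submodule.subset_span ⟨0, rfl⟩))
        (Submodule.smul_mem _ _ (Submodule.subset_span ⟨1, rfl⟩))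
    · intro w hw
      obtain ⟨d, hd⟩ := (Submodule.mem_span_range_iff_exists_fun ℂ).1 hw
      rw [← hd, Fin.sum_univ_two]
      simp only [Matrix.cons_val_zero, Matrix.cons_val_one, LinearMap.smul_apply, map_add,
        map_smul, h₁, h₂, smul_smul, inv_mul_cancel₀ hc, mul_one]
  have htr : LinearMap.trace ℂ W (c⁻¹ • f) = (Module.finrank ℂ ↥L : ℂ) := hproj.trace
  have hrank : Module.finrank ℂ ↥L = 2 := by
    rw [hL, finrank_span_eq_card hli]
    simp
  rw [map_smul, hrank, smul_eq_mul] at htr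
  have : LinearMap.trace ℂ W f = c * (c⁻¹ * LinearMap.trace ℂ W f) := by
    rw [← mul_assoc, mul_inv_cancel₀ hc, one_mul]
  rw [this, htr]
  push_cast
  ring

/-- **The Killing form of the E³-type skeleton** (PART 3b of the rank-six Θ-subalgebra theorem). For a subspace
`𝔊 ⊆ End(M)` closed under `Z ↦ XZ − ZX` (`X ∈ 𝔊`) and spanned by `C₁, T, B₀, S, E′, F′` with the multiplication
table of `𝔰𝔩₂ ⊕ 𝔰𝔬₃` — `[C₁,T] = 2C₁`, `[C₁,B₀] = −T`, `[T,B₀] = 2B₀`, `S, E′, F′` commuting with `C₁, T, B₀`,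
`[S,E′] = eE′`, `[S,F′] = −eF′`, `[E′,F′] = e⁻¹S`, `e ≠ 0` — and `E′, F′` resp. `T, B₀` linearly independent, the
Killing form `κ(X,Y) = tr_𝔊(ad X ∘ ad Y)`, `ad X = (L_X − R_X)|_𝔊`, has the values
`κ(S,S) = 2e²`, `κ(S,E′) = κ(S,F′) = 0`, `κ(B₀,C₁) = κ(C₁,B₀) = 4`, `κ(T,B₀) = κ(B₀,B₀) = κ(T,C₁) = κ(C₁,C₁) = 0`,
and `κ(s,a) = 0` for `s ∈ {S,E′,F′}`, `a ∈ {C₁,T,B₀}`.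
[cite: Humphreys1972, §5.1 (Killing form κ(x,y) = Tr(ad x ad y); example 𝔰𝔩(2,F))];
[cite: MoonenZarhin1999LowDim, §2 (2.3), (2.5)] -/
theorem SymplecticThetaSix.skeleton_killing [FiniteDimensional ℂ M] (𝔊 : Submodule ℂ (Module.End ℂ M))
    (had : ∀ X ∈ 𝔊, ∀ Z ∈ 𝔊, (LinearMap.mulLeft ℂ X - LinearMap.mulRight ℂ X) Z ∈ 𝔊)
    {C₁ T B₀ S E' F' : Module.End ℂ M} (hC₁ : C₁ ∈ 𝔊) (hT : T ∈ 𝔊) (hB₀ : B₀ ∈ 𝔊) (hS : S ∈ 𝔊)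
    (hE' : E' ∈ 𝔊) (hF' : F' ∈ 𝔊)
    (hspan : ∀ Z ∈ 𝔊, ∃ c y b x u v : ℂ, Z = c • C₁ + y • T + b • B₀ + x • S + u • E' + v • F')
    (hliEF : LinearIndependent ℂ ![E', F']) (hliTB : LinearIndependent ℂ ![T, B₀])
    (hC₁T : C₁ * T - T * C₁ = (2 : ℂ) • C₁) (hC₁B₀ : C₁ * B₀ - B₀ * C₁ = -T)
    (hTB₀ : T * B₀ - B₀ * T = (2 : ℂ) • B₀)
    (hSC : S * C₁ = C₁ * S) (hST : S * T = T * S) (hSB : S * B₀ = B₀ * S)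
    (hEC : E' * C₁ = C₁ * E') (hET : E' * T = T * E') (hEB : E' * B₀ = B₀ * E')
    (hFC : F' * C₁ = C₁ * F') (hFT : F' * T = T * F') (hFB : F' * B₀ = B₀ * F')
    {e : ℂ} (he : e ≠ 0) (hSE : S * E' - E' * S = e • E') (hSF : S * F' - F' * S = -(e • F'))
    (hEF : E' * F' - F' * E' = e⁻¹ • S) :
    let ad : ∀ X : Module.End ℂ M, X ∈ 𝔊 → (↥𝔊 →ₗ[ℂ] ↥𝔊) :=
      fun X hX => (LinearMap.mulLeft ℂ X - LinearMap.mulRight ℂ X).restrict (had X hX)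
    LinearMap.trace ℂ ↥𝔊 (ad S hS ∘ₗ ad S hS) = 2 * e ^ 2 ∧
    LinearMap.trace ℂ ↥𝔊 (ad S hS ∘ₗ ad E' hE') = 0 ∧
    LinearMap.trace ℂ ↥𝔊 (ad S hS ∘ₗ ad F' hF') = 0 ∧
    LinearMap.trace ℂ ↥𝔊 (ad B₀ hB₀ ∘ₗ ad C₁ hC₁) = 4 ∧
    LinearMap.trace ℂ ↥𝔊 (ad C₁ hC₁ ∘ₗ ad B₀ hB₀) = 4 ∧
    LinearMap.trace ℂ ↥𝔊 (ad T hT ∘ₗ ad B₀ hB₀) = 0 ∧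
    LinearMap.trace ℂ ↥𝔊 (ad B₀ hB₀ ∘ₗ ad B₀ hB₀) = 0 ∧
    LinearMap.trace ℂ ↥𝔊 (ad T hT ∘ₗ ad C₁ hC₁) = 0 ∧
    LinearMap.trace ℂ ↥𝔊 (ad C₁ hC₁ ∘ₗ ad C₁ hC₁) = 0 ∧
    LinearMap.trace ℂ ↥𝔊 (ad S hS ∘ₗ ad C₁ hC₁) = 0 ∧
    LinearMap.trace ℂ ↥𝔊 (ad S hS ∘ₗ ad T hT) = 0 ∧
    LinearMap.trace ℂ ↥𝔊 (ad S hS ∘ₗ ad B₀ hB₀) = 0 ∧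
    LinearMap.trace ℂ ↥𝔊 (ad E' hE' ∘ₗ ad C₁ hC₁) = 0 ∧
    LinearMap.trace ℂ ↥𝔊 (ad E' hE' ∘ₗ ad T hT) = 0 ∧
    LinearMap.trace ℂ ↥𝔊 (ad E' hE' ∘ₗ ad B₀ hB₀) = 0 ∧
    LinearMap.trace ℂ ↥𝔊 (ad F' hF' ∘ₗ ad C₁ hC₁) = 0 ∧
    LinearMap.trace ℂ ↥𝔊 (ad F' hF' ∘ₗ ad T hT) = 0 ∧
    LinearMap.trace ℂ ↥𝔊 (ad F' hF' ∘ₗ ad B₀ hB₀) = 0 := by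
  intro ad
  -- the composite `ad X ∘ ad Y` on an element of `𝔊`, as an operator on `M`
  have hcomp : ∀ (X : Module.End ℂ M) (hX : X ∈ 𝔊) (Y : Module.End ℂ M) (hY : Y ∈ 𝔊) (w : ↥𝔊),
      (((ad X hX ∘ₗ ad Y hY) w : ↥𝔊) : Module.End ℂ M) = X * (Y * w - w * Y) - (Y * w - w * Y) * X := by
    intro X hX Y hY w
    rfl
  have had1 : ∀ (X : Module.End ℂ M) (hX : X ∈ 𝔊) (w : ↥𝔊),
      ((ad X hX w : ↥𝔊) : Module.End ℂ M) = X * w - w * X := by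
    intro X hX w
    rfl
  -- reordering rules (normal order `C₁ < T < B₀ < S < E′ < F′`)
  have rTC : T * C₁ = C₁ * T - (2 : ℂ) • C₁ := by rw [← hC₁T]; abel
  have rBC : B₀ * C₁ = C₁ * B₀ + T := by
    have : T = -(C₁ * B₀ - B₀ * C₁) := by rw [hC₁B₀, neg_neg]
    rw [this]; abel
  have rBT : B₀ * T = T * B₀ - (2 : ℂ) • B₀ := by rw [← hTB₀]; abel
  have rES : E' * S = S * E' - e • E' := by rw [← hSE]; abel
  have rFS : F' * S = S * F' + e • F' := by
    have : e • F' = -(S * F' - F' * S) := by rw [hSF, neg_neg]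
    rw [this]; abel
  have rFE : F' * E' = E' * F' - e⁻¹ • S := by rw [← hEF]; abel
  -- inner brackets with a general element `Z = cC₁ + yT + bB₀ + xS + uE′ + vF′`
  have iS : ∀ c y b x u v : ℂ,
      S * (c • C₁ + y • T + b • B₀ + x • S + u • E' + v • F') -
        (c • C₁ + y • T + b • B₀ + x • S + u • E' + v • F') * S = (u * e) • E' - (v * e) • F' := by
    intro c y b x u v
    simp only [mul_add, add_mul, mul_smul_comm, smul_mul_assoc, hSC, hST, hSB, rES, rFS]
    module
  have iE : ∀ c y b x u v : ℂ,
      E' * (c • C₁ + y • T + b • B₀ + x • S + u • E' + v • F') -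
        (c • C₁ + y • T + b • B₀ + x • S + u • E' + v • F') * E' = -((x * e) • E') + (v * e⁻¹) • S := by
    intro c y b x u v
    simp only [mul_add, add_mul, mul_smul_comm, smul_mul_assoc, hEC, hET, hEB, rES, rFE]
    module
  have iF : ∀ c y b x u v : ℂ,
      F' * (c • C₁ + y • T + b • B₀ + x • S + u • E' + v • F') -
        (c • C₁ + y • T + b • B₀ + x • S + u • E' + v • F') * F' = (x * e) • F' - (u * e⁻¹) • S := by
    intro c y b x u v
    simp only [mul_add, add_mul, mul_smul_comm, smul_mul_assoc, hFC, hFT, hFB, rFS, rFE]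
    module
  have iC : ∀ c y b x u v : ℂ,
      C₁ * (c • C₁ + y • T + b • B₀ + x • S + u • E' + v • F') -
        (c • C₁ + y • T + b • B₀ + x • S + u • E' + v • F') * C₁ = (2 * y) • C₁ - b • T := by
    intro c y b x u v
    simp only [mul_add, add_mul, mul_smul_comm, smul_mul_assoc, hSC, hEC, hFC, rTC, rBC]
    module
  have iB : ∀ c y b x u v : ℂ,
      B₀ * (c • C₁ + y • T + b • B₀ + x • S + u • E' + v • F') -
        (c • C₁ + y • T + b • B₀ + x • S + u • E' + v • F') * B₀ = c • T - (2 * y) • B₀ := by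
    intro c y b x u v
    simp only [mul_add, add_mul, mul_smul_comm, smul_mul_assoc, hSB, hEB, hFB, rBC, rBT]
    module
  have iT : ∀ c y b x u v : ℂ,
      T * (c • C₁ + y • T + b • B₀ + x • S + u • E' + v • F') -
        (c • C₁ + y • T + b • B₀ + x • S + u • E' + v • F') * T = -((2 * c) • C₁) + (2 * b) • B₀ := by
    intro c y b x u v
    simp only [mul_add, add_mul, mul_smul_comm, smul_mul_assoc, hST, hET, hFT, rTC, rBT]
    module
  -- linear independence inside `𝔊`
  have hliEF' : LinearIndependent ℂ ![(⟨E', hE'⟩ : ↥𝔊), ⟨F', hF'⟩] := by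
    rw [LinearIndependent.pair_iff]
    intro s t hst
    have h := congrArg Subtype.val hst
    simp only [Submodule.coe_add, Submodule.coe_smul, Submodule.coe_zero] at h
    exact LinearIndependent.pair_iff.1 hliEF s t h
  have hliTB' : LinearIndependent ℂ ![(⟨T, hT⟩ : ↥𝔊), ⟨B₀, hB₀⟩] := by
    rw [LinearIndependent.pair_iff]
    intro s t hst
    have h := congrArg Subtype.val hst
    simp only [Submodule.coe_add, Submodule.coe_smul, Submodule.coe_zero] at h
    exact LinearIndependent.pair_iff.1 hliTB s t h
  -- (1) κ(S,S) = 2e²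
  have κSS : LinearMap.trace ℂ ↥𝔊 (ad S hS ∘ₗ ad S hS) = 2 * e ^ 2 := by
    refine SymplecticThetaSix.trace_eq_two_mul _ (pow_ne_zero 2 he) hliEF' ?_ ?_ ?_
    · intro w
      obtain ⟨c, y, b, x, u, v, hw⟩ := hspan w w.2
      refine ⟨u, v, Subtype.ext ?_⟩
      rw [hcomp S hS S hS w, hw, iS]
      simp only [mul_sub, sub_mul, mul_smul_comm, smul_mul_assoc, rES, rFS, Submodule.coe_add, Submodule.coe_smul]
      module
    · apply Subtype.ext
      rw [hcomp S hS S hS]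
      simp only [mul_sub, sub_mul, mul_smul_comm, smul_mul_assoc, rES, Submodule.coe_smul]
      module
    · apply Subtype.ext
      rw [hcomp S hS S hS]
      simp only [mul_add, add_mul, mul_sub, sub_mul, mul_smul_comm, smul_mul_assoc, rFS, Submodule.coe_smul]
      module
  -- (2) κ(B₀,C₁) = 4 and κ(C₁,B₀) = 4
  have κBC : LinearMap.trace ℂ ↥𝔊 (ad B₀ hB₀ ∘ₗ ad C₁ hC₁) = 4 := by
    have h := SymplecticThetaSix.trace_eq_two_mul (ad B₀ hB₀ ∘ₗ ad C₁ hC₁) (two_ne_zero (α := ℂ)) hliTB'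
      ?_ ?_ ?_
    · rw [h]; norm_num
    · intro w
      obtain ⟨c, y, b, x, u, v, hw⟩ := hspan w w.2
      refine ⟨y, b, Subtype.ext ?_⟩
      rw [hcomp B₀ hB₀ C₁ hC₁ w, hw, iC]
      simp only [mul_sub, sub_mul, mul_smul_comm, smul_mul_assoc, rBC, rBT, Submodule.coe_add, Submodule.coe_smul]
      module
    · apply Subtype.ext
      rw [hcomp B₀ hB₀ C₁ hC₁]
      simp only [mul_sub, sub_mul, mul_smul_comm, smul_mul_assoc, rTC, rBC, Submodule.coe_smul]
      module
    · apply Subtype.ext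
      rw [hcomp B₀ hB₀ C₁ hC₁]
      simp only [mul_add, add_mul, mul_sub, sub_mul, rBC, rBT, Submodule.coe_smul]
      module
  have κCB : LinearMap.trace ℂ ↥𝔊 (ad C₁ hC₁ ∘ₗ ad B₀ hB₀) = 4 := by
    have h := LinearMap.trace_mul_comm ℂ (ad C₁ hC₁) (ad B₀ hB₀)
    rw [Module.End.mul_eq_comp, Module.End.mul_eq_comp] at h
    rw [h, κBC]
  -- (3) square-zero compositions
  have κSE : LinearMap.trace ℂ ↥𝔊 (ad S hS ∘ₗ ad E' hE') = 0 := by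
    refine SymplecticThetaSix.trace_eq_zero_of_comp_self _ fun w => ?_
    obtain ⟨c, y, b, x, u, v, hw⟩ := hspan w w.2
    have hfw : (ad S hS ∘ₗ ad E' hE') w = (-(x * e ^ 2)) • (⟨E', hE'⟩ : ↥𝔊) := Subtype.ext (by
      rw [hcomp S hS E' hE' w, hw, iE]
      simp only [mul_add, add_mul, mul_smul_comm, smul_mul_assoc, mul_neg, neg_mul, neg_smul, rES, Submodule.coe_smul]
      module)
    have hfE : (ad S hS ∘ₗ ad E' hE') ⟨E', hE'⟩ = 0 := Subtype.ext (by
      rw [hcomp S hS E' hE']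
      simp only [mul_sub, sub_mul, Submodule.coe_zero]
      module)
    rw [hfw, map_smul, hfE, smul_zero]
  have κSF : LinearMap.trace ℂ ↥𝔊 (ad S hS ∘ₗ ad F' hF') = 0 := by
    refine SymplecticThetaSix.trace_eq_zero_of_comp_self _ fun w => ?_
    obtain ⟨c, y, b, x, u, v, hw⟩ := hspan w w.2
    have hfw : (ad S hS ∘ₗ ad F' hF') w = (-(x * e ^ 2)) • (⟨F', hF'⟩ : ↥𝔊) := Subtype.ext (by
      rw [hcomp S hS F' hF' w, hw, iF]
      simp only [mul_sub, sub_mul, mul_smul_comm, smul_mul_assoc, neg_smul, rFS, Submodule.coe_smul]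
      module)
    have hfF : (ad S hS ∘ₗ ad F' hF') ⟨F', hF'⟩ = 0 := Subtype.ext (by
      rw [hcomp S hS F' hF']
      simp only [mul_sub, sub_mul, Submodule.coe_zero]
      module)
    rw [hfw, map_smul, hfF, smul_zero]
  have κTB : LinearMap.trace ℂ ↥𝔊 (ad T hT ∘ₗ ad B₀ hB₀) = 0 := by
    refine SymplecticThetaSix.trace_eq_zero_of_comp_self _ fun w => ?_
    obtain ⟨c, y, b, x, u, v, hw⟩ := hspan w w.2
    have hfw : (ad T hT ∘ₗ ad B₀ hB₀) w = (-(4 * y)) • (⟨B₀, hB₀⟩ : ↥𝔊) := Subtype.ext (by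
      rw [hcomp T hT B₀ hB₀ w, hw, iB]
      simp only [mul_sub, sub_mul, mul_smul_comm, smul_mul_assoc, neg_smul, rBT, Submodule.coe_smul]
      module)
    have hfB : (ad T hT ∘ₗ ad B₀ hB₀) ⟨B₀, hB₀⟩ = 0 := Subtype.ext (by
      rw [hcomp T hT B₀ hB₀]
      simp only [mul_sub, sub_mul, Submodule.coe_zero]
      module)
    rw [hfw, map_smul, hfB, smul_zero]
  have κBB : LinearMap.trace ℂ ↥𝔊 (ad B₀ hB₀ ∘ₗ ad B₀ hB₀) = 0 := by
    refine SymplecticThetaSix.trace_eq_zero_of_comp_self _ fun w => ?_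
    obtain ⟨c, y, b, x, u, v, hw⟩ := hspan w w.2
    have hfw : (ad B₀ hB₀ ∘ₗ ad B₀ hB₀) w = (-(2 * c)) • (⟨B₀, hB₀⟩ : ↥𝔊) := Subtype.ext (by
      rw [hcomp B₀ hB₀ B₀ hB₀ w, hw, iB]
      simp only [mul_sub, sub_mul, mul_smul_comm, smul_mul_assoc, neg_smul, rBT, Submodule.coe_smul]
      module)
    have hfB : (ad B₀ hB₀ ∘ₗ ad B₀ hB₀) ⟨B₀, hB₀⟩ = 0 := Subtype.ext (by
      rw [hcomp B₀ hB₀ B₀ hB₀]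
      simp only [mul_sub, sub_mul, Submodule.coe_zero]
      module)
    rw [hfw, map_smul, hfB, smul_zero]
  have κTC : LinearMap.trace ℂ ↥𝔊 (ad T hT ∘ₗ ad C₁ hC₁) = 0 := by
    refine SymplecticThetaSix.trace_eq_zero_of_comp_self _ fun w => ?_
    obtain ⟨c, y, b, x, u, v, hw⟩ := hspan w w.2
    have hfw : (ad T hT ∘ₗ ad C₁ hC₁) w = (-(4 * y)) • (⟨C₁, hC₁⟩ : ↥𝔊) := Subtype.ext (by
      rw [hcomp T hT C₁ hC₁ w, hw, iC]
      simp only [mul_sub, sub_mul, mul_smul_comm, smul_mul_assoc, neg_smul, rTC, Submodule.coe_smul]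
      module)
    have hfC : (ad T hT ∘ₗ ad C₁ hC₁) ⟨C₁, hC₁⟩ = 0 := Subtype.ext (by
      rw [hcomp T hT C₁ hC₁]
      simp only [mul_sub, sub_mul, Submodule.coe_zero]
      module)
    rw [hfw, map_smul, hfC, smul_zero]
  have κCC : LinearMap.trace ℂ ↥𝔊 (ad C₁ hC₁ ∘ₗ ad C₁ hC₁) = 0 := by
    refine SymplecticThetaSix.trace_eq_zero_of_comp_self _ fun w => ?_
    obtain ⟨c, y, b, x, u, v, hw⟩ := hspan w w.2
    have hfw : (ad C₁ hC₁ ∘ₗ ad C₁ hC₁) w = (-(2 * b)) • (⟨C₁, hC₁⟩ : ↥𝔊) := Subtype.ext (by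
      rw [hcomp C₁ hC₁ C₁ hC₁ w, hw, iC]
      simp only [mul_sub, sub_mul, mul_smul_comm, smul_mul_assoc, neg_smul, rTC, Submodule.coe_smul]
      module)
    have hfC : (ad C₁ hC₁ ∘ₗ ad C₁ hC₁) ⟨C₁, hC₁⟩ = 0 := Subtype.ext (by
      rw [hcomp C₁ hC₁ C₁ hC₁]
      simp only [mul_sub, sub_mul, Submodule.coe_zero]
      module)
    rw [hfw, map_smul, hfC, smul_zero]
  -- (4) mixed pairs: `ad a ∘ ad s = 0` for `a ∈ {C₁,T,B₀}`, `s ∈ {S,E′,F′}`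
  have hmixed : ∀ (a : Module.End ℂ M) (ha : a ∈ 𝔊), a * S = S * a → a * E' = E' * a → a * F' = F' * a →
      ∀ (s : Module.End ℂ M) (hs : s ∈ 𝔊), (s = S ∨ s = E' ∨ s = F') →
      LinearMap.trace ℂ ↥𝔊 (ad s hs ∘ₗ ad a ha) = 0 := by
    intro a ha haS haE haF s hs hs3
    have hzero : ad a ha ∘ₗ ad s hs = 0 := by
      ext w
      obtain ⟨c, y, b, x, u, v, hw⟩ := hspan w w.2
      rw [hcomp a ha s hs w, hw, LinearMap.zero_apply, ZeroMemClass.coe_zero]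
      rcases hs3 with rfl | rfl | rfl
      · rw [iS, mul_sub, sub_mul, mul_smul_comm, mul_smul_comm, smul_mul_assoc, smul_mul_assoc, haE, haF, sub_self]
      · rw [iE, mul_add, add_mul, mul_neg, neg_mul, mul_smul_comm, mul_smul_comm, smul_mul_assoc, smul_mul_assoc,
          haE, haS, sub_self]
      · rw [iF, mul_sub, sub_mul, mul_smul_comm, mul_smul_comm, smul_mul_assoc, smul_mul_assoc, haF, haS, sub_self]
    have h := LinearMap.trace_mul_comm ℂ (ad s hs) (ad a ha)
    rw [Module.End.mul_eq_comp, Module.End.mul_eq_comp] at h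
    rw [h, hzero, map_zero]
  have hTS : T * S = S * T := hST.symm
  have hTE : T * E' = E' * T := hET.symm
  have hTF : T * F' = F' * T := hFT.symm
  exact ⟨κSS, κSE, κSF, κBC, κCB, κTB, κBB, κTC, κCC,
    hmixed C₁ hC₁ hSC.symm hEC.symm hFC.symm S hS (Or.inl rfl),
    hmixed T hT hTS hTE hTF S hS (Or.inl rfl),
    hmixed B₀ hB₀ hSB.symm hEB.symm hFB.symm S hS (Or.inl rfl),
    hmixed C₁ hC₁ hSC.symm hEC.symm hFC.symm E' hE' (Or.inr (Or.inl rfl)),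
    hmixed T hT hTS hTE hTF E' hE' (Or.inr (Or.inl rfl)),
    hmixed B₀ hB₀ hSB.symm hEB.symm hFB.symm E' hE' (Or.inr (Or.inl rfl)),
    hmixed C₁ hC₁ hSC.symm hEC.symm hFC.symm F' hF' (Or.inr (Or.inr rfl)),
    hmixed T hT hTS hTE hTF F' hF' (Or.inr (Or.inr rfl)),
    hmixed B₀ hB₀ hSB.symm hEB.symm hFB.symm F' hF' (Or.inr (Or.inr rfl))⟩

end HodgeStructure

end Literature.AlgebraicGeometry.Motives
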